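import Mathlib
import Summits.Ventures.PercRepro2.Defs
import Summits.Ventures.PercRepro2.Graph
import Summits.Ventures.PercRepro2.Events
import Summits.Ventures.PercRepro2.Harris
import Summits.Ventures.PercRepro2.HCov

/-!
# The diagonal of the covariance form: `o = b` (row 2′HCOV-DIAG; blind cell PercRepro2, mine-2 g13)

`Gc` with `o := b` is a polynomial with POSITIVE coefficients in the nine partition atoms under
`Q = {a₁ ↮ a₂}`: with `T′ = Q ∩ {a₃ ∈ C₁}`, `T = Q ∩ {a₃ ∈ C₂}`, `PD = Q ∩ {a₃ ∉ U}`,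
`bL = {a₁ ↔ b}`, `bH = {a₂ ↔ b}`, `b∅ = bLᶜ ∩ bHᶜ`,

  `A₁ = P(T′ ∩ bL)`, `A₂ = P(T′ ∩ bH)`, `A₀ = P(T′ ∩ b∅)`, `B₁ = P(T ∩ bL)`, `B₂ = P(T ∩ bH)`,
  `B₀ = P(T ∩ b∅)`, `p₁ = P(PD ∩ bL)`, `p₂ = P(PD ∩ bH)`, `p₀ = P(PD ∩ b∅)`,

`Gc p ends b a₁ a₂ a₃ b` equals a 44-monomial cubic (`Gc_diag_eq`), every coefficient in
`{2, 4, 6, 8}` (MINE2-CUTVERTEX.md §13.19; the expansion was produced by exact polynomial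
arithmetic and is re-verified here by `ring`). Hence the diagonal (HCOV) holds for EVERY weighted
graph and EVERY choice of the four vertices — no Harris, no BHK, and no distinctness is needed.
It closes the two-far-mark cut-vertex class «`o` and `b` behind a cut vertex» (§13.13).
-/

namespace Summit.Ventures.PercRepro2
namespace HCovDiag

open CovForm

variable {V : Type*} {E : Type*} [Fintype E] [DecidableEq E] [DecidableEq V]
  {R : Type*} [Field R] [LinearOrder R] [IsStrictOrderedRing R]

omit [Fintype E] [DecidableEq E] [DecidableEq V] in
/-- The diagonal cubic is nonnegative on nonnegative atoms. -/
lemma poly_nonneg {A₀ A₁ A₂ B₀ B₁ B₂ p₀ p₁ p₂ : R} (hA₀ : 0 ≤ A₀) (hA₁ : 0 ≤ A₁) (hA₂ : 0 ≤ A₂)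
    (hB₀ : 0 ≤ B₀) (hB₁ : 0 ≤ B₁) (hB₂ : 0 ≤ B₂) (hp₀ : 0 ≤ p₀) (hp₁ : 0 ≤ p₁) (hp₂ : 0 ≤ p₂) :
    0 ≤ 2 * A₀ * A₂ * p₀ + 2 * A₀ * A₂ * p₁ + 2 * A₀ * A₂ * p₂ + 2 * A₀ * B₁ * p₀ + 2 * A₀ * B₂ * p₁ +
        2 * A₀ * B₂ * p₂ + 2 * A₀ * p₁ * p₂ + 2 * A₀ * p₂ * p₂ + 4 * A₁ * A₂ * p₀ + 4 * A₁ * A₂ * p₁ +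
        4 * A₁ * A₂ * p₂ + 2 * A₁ * B₀ * p₁ + 2 * A₁ * B₀ * p₂ + 4 * A₁ * B₂ * p₁ + 4 * A₁ * B₂ * p₂ +
        2 * A₁ * p₀ * p₂ + 4 * A₁ * p₁ * p₂ + 4 * A₁ * p₂ * p₂ + 2 * A₂ * B₀ * p₀ + 8 * A₂ * B₁ * p₀ +
        4 * A₂ * B₁ * p₁ + 4 * A₂ * B₁ * p₂ + 2 * A₂ * p₀ * p₀ + 6 * A₂ * p₀ * p₁ + 4 * A₂ * p₁ * p₁ +
        4 * A₂ * p₁ * p₂ + 2 * B₀ * B₁ * p₀ + 2 * B₀ * B₁ * p₁ + 2 * B₀ * B₁ * p₂ + 2 * B₀ * p₁ * p₁ +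
        2 * B₀ * p₁ * p₂ + 4 * B₁ * B₂ * p₀ + 4 * B₁ * B₂ * p₁ + 4 * B₁ * B₂ * p₂ + 2 * B₁ * p₀ * p₀ +
        6 * B₁ * p₀ * p₂ + 4 * B₁ * p₁ * p₂ + 4 * B₁ * p₂ * p₂ + 2 * B₂ * p₀ * p₁ + 4 * B₂ * p₁ * p₁ +
        4 * B₂ * p₁ * p₂ + 4 * p₀ * p₁ * p₂ + 4 * p₁ * p₁ * p₂ + 4 * p₁ * p₂ * p₂ := by
  positivity

omit [Fintype E] [DecidableEq E] [DecidableEq V] in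
/-- A sub-event of `Q` meets `bL ∩ bH` trivially. -/
lemma inter_both_eq_empty (ends : E → Sym2 V) (a₁ a₂ b : V) (W : Set (Config E))
    (hW : ∀ ω ∈ W, ¬ Conn ends ω a₂ a₁) :
    W ∩ (connEvent ends a₁ b ∩ connEvent ends a₂ b) = ∅ := by
  ext ω
  simp only [Set.mem_inter_iff, mem_connEvent, Set.mem_empty_iff_false, iff_false, not_and]
  intro h h1 h2
  exact hW ω h (conn_trans h2 (conn_symm h1))

omit [Fintype E] [DecidableEq E] [DecidableEq V] in
/-- Same, other order of the two connections. -/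
lemma inter_both_eq_empty' (ends : E → Sym2 V) (a₁ a₂ b : V) (W : Set (Config E))
    (hW : ∀ ω ∈ W, ¬ Conn ends ω a₂ a₁) :
    W ∩ (connEvent ends a₂ b ∩ connEvent ends a₁ b) = ∅ := by
  rw [Set.inter_comm (connEvent ends a₂ b)]
  exact inter_both_eq_empty ends a₁ a₂ b W hW

omit [DecidableEq V] [LinearOrder R] [IsStrictOrderedRing R] in
/-- `P(W) = P(W ∩ bL) + P(W ∩ bH) + P(W ∩ bLᶜ ∩ bHᶜ)` for a sub-event `W` of `Q`. -/
lemma prob_split_b (p : E → R) (ends : E → Sym2 V) (a₁ a₂ b : V) (W : Set (Config E))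
    (hW : ∀ ω ∈ W, ¬ Conn ends ω a₂ a₁) :
    prob p W = prob p (W ∩ connEvent ends a₁ b) + prob p (W ∩ connEvent ends a₂ b) +
      prob p (W ∩ (connEvent ends a₁ b)ᶜ ∩ (connEvent ends a₂ b)ᶜ) := by
  have h1 := prob_inter_add_prob_inter_compl p W (connEvent ends a₁ b)
  have h2 := prob_inter_add_prob_inter_compl p (W ∩ (connEvent ends a₁ b)ᶜ) (connEvent ends a₂ b)
  have h3 : W ∩ (connEvent ends a₁ b)ᶜ ∩ connEvent ends a₂ b = W ∩ connEvent ends a₂ b := by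
    ext ω
    simp only [Set.mem_inter_iff, Set.mem_compl_iff, mem_connEvent]
    constructor
    · rintro ⟨⟨h, _⟩, h2⟩; exact ⟨h, h2⟩
    · rintro ⟨h, h2⟩
      exact ⟨⟨h, fun h1 => hW ω h (conn_trans h2 (conn_symm h1))⟩, h2⟩
  rw [h3] at h2
  linear_combination -h1 - h2

omit [Fintype E] [DecidableEq E] [DecidableEq V] in
/-- `T ⊆ Q`. -/
lemma T_sub (ends : E → Sym2 V) (a₁ a₂ a₃ : V) : ∀ ω ∈ TEvent ends a₁ a₂ a₃, ¬ Conn ends ω a₂ a₁ :=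
  fun _ h => h.1

omit [Fintype E] [DecidableEq E] [DecidableEq V] in
/-- `T′ ⊆ Q`. -/
lemma T'_sub (ends : E → Sym2 V) (a₁ a₂ a₃ : V) : ∀ ω ∈ TEvent ends a₂ a₁ a₃, ¬ Conn ends ω a₂ a₁ :=
  fun _ h h' => h.1 (conn_symm h')

omit [Fintype E] [DecidableEq E] [DecidableEq V] in
/-- `PD ⊆ Q`. -/
lemma PD_sub (ends : E → Sym2 V) (a₁ a₂ a₃ : V) : ∀ ω ∈ PDEvent ends a₁ a₂ a₃, ¬ Conn ends ω a₂ a₁ :=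
  fun _ h h' => h.1 (conn_symm h')

omit [Fintype E] [DecidableEq E] [DecidableEq V] in
/-- `Q` itself: `a₂ ↮ a₁`. -/
lemma Q_sub (ends : E → Sym2 V) (a₁ a₂ : V) : ∀ ω ∈ avoidAll ends a₂ {a₁}, ¬ Conn ends ω a₂ a₁ :=
  fun _ h => h a₁ (Finset.mem_singleton_self a₁)

/-- **`Gc` on the diagonal `o = b` is a positive-coefficient cubic** in the nine atoms
`A₁ = P(T′, bL)`, `A₂ = P(T′, bH)`, `A₀ = P(T′, b ∉ U)`, `B₁, B₂, B₀` (the same for `T`),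
`p₁, p₂, p₀` (the same for `PD`): 44 monomials, every coefficient in `{2, 4, 6, 8}`. -/
theorem Gc_diag_eq (p : E → R) (ends : E → Sym2 V) (a₁ a₂ a₃ b : V) :
    let A₀ := prob p (TEvent ends a₂ a₁ a₃ ∩ (connEvent ends a₁ b)ᶜ ∩ (connEvent ends a₂ b)ᶜ)
    let A₁ := prob p (TEvent ends a₂ a₁ a₃ ∩ connEvent ends a₁ b)
    let A₂ := prob p (TEvent ends a₂ a₁ a₃ ∩ connEvent ends a₂ b)
    let B₀ := prob p (TEvent ends a₁ a₂ a₃ ∩ (connEvent ends a₁ b)ᶜ ∩ (connEvent ends a₂ b)ᶜ)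
    let B₁ := prob p (TEvent ends a₁ a₂ a₃ ∩ connEvent ends a₁ b)
    let B₂ := prob p (TEvent ends a₁ a₂ a₃ ∩ connEvent ends a₂ b)
    let p₀ := prob p (PDEvent ends a₁ a₂ a₃ ∩ (connEvent ends a₁ b)ᶜ ∩ (connEvent ends a₂ b)ᶜ)
    let p₁ := prob p (PDEvent ends a₁ a₂ a₃ ∩ connEvent ends a₁ b)
    let p₂ := prob p (PDEvent ends a₁ a₂ a₃ ∩ connEvent ends a₂ b)
    Gc p ends b a₁ a₂ a₃ b =
      2 * A₀ * A₂ * p₀ + 2 * A₀ * A₂ * p₁ + 2 * A₀ * A₂ * p₂ + 2 * A₀ * B₁ * p₀ + 2 * A₀ * B₂ * p₁ +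
        2 * A₀ * B₂ * p₂ + 2 * A₀ * p₁ * p₂ + 2 * A₀ * p₂ * p₂ + 4 * A₁ * A₂ * p₀ + 4 * A₁ * A₂ * p₁ +
        4 * A₁ * A₂ * p₂ + 2 * A₁ * B₀ * p₁ + 2 * A₁ * B₀ * p₂ + 4 * A₁ * B₂ * p₁ + 4 * A₁ * B₂ * p₂ +
        2 * A₁ * p₀ * p₂ + 4 * A₁ * p₁ * p₂ + 4 * A₁ * p₂ * p₂ + 2 * A₂ * B₀ * p₀ + 8 * A₂ * B₁ * p₀ +
        4 * A₂ * B₁ * p₁ + 4 * A₂ * B₁ * p₂ + 2 * A₂ * p₀ * p₀ + 6 * A₂ * p₀ * p₁ + 4 * A₂ * p₁ * p₁ +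
        4 * A₂ * p₁ * p₂ + 2 * B₀ * B₁ * p₀ + 2 * B₀ * B₁ * p₁ + 2 * B₀ * B₁ * p₂ + 2 * B₀ * p₁ * p₁ +
        2 * B₀ * p₁ * p₂ + 4 * B₁ * B₂ * p₀ + 4 * B₁ * B₂ * p₁ + 4 * B₁ * B₂ * p₂ + 2 * B₁ * p₀ * p₀ +
        6 * B₁ * p₀ * p₂ + 4 * B₁ * p₁ * p₂ + 4 * B₁ * p₂ * p₂ + 2 * B₂ * p₀ * p₁ + 4 * B₂ * p₁ * p₁ +
        4 * B₂ * p₁ * p₂ + 4 * p₀ * p₁ * p₂ + 4 * p₁ * p₁ * p₂ + 4 * p₁ * p₂ * p₂ := by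
  intro A₀ A₁ A₂ B₀ B₁ B₂ p₀ p₁ p₂
  -- the cross terms vanish under `Q`
  have eQ := inter_both_eq_empty ends a₁ a₂ b _ (Q_sub ends a₁ a₂)
  have eQ' := inter_both_eq_empty' ends a₁ a₂ b _ (Q_sub ends a₁ a₂)
  have eT := inter_both_eq_empty ends a₁ a₂ b _ (T_sub ends a₁ a₂ a₃)
  have eT' := inter_both_eq_empty' ends a₁ a₂ b _ (T_sub ends a₁ a₂ a₃)
  have eTp := inter_both_eq_empty ends a₁ a₂ b _ (T'_sub ends a₁ a₂ a₃)
  have eTp' := inter_both_eq_empty' ends a₁ a₂ b _ (T'_sub ends a₁ a₂ a₃)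
  have ePD := inter_both_eq_empty ends a₁ a₂ b _ (PD_sub ends a₁ a₂ a₃)
  have ePD' := inter_both_eq_empty' ends a₁ a₂ b _ (PD_sub ends a₁ a₂ a₃)
  -- the splits
  have sQ := Qsplit_univ p ends a₁ a₂ a₃
  have sQL := Qsplit p ends a₁ a₂ a₃ (connEvent ends a₁ b)
  have sQH := Qsplit p ends a₁ a₂ a₃ (connEvent ends a₂ b)
  have sT := prob_split_b p ends a₁ a₂ b _ (T_sub ends a₁ a₂ a₃)
  have sTp := prob_split_b p ends a₁ a₂ b _ (T'_sub ends a₁ a₂ a₃)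
  have sPD := prob_split_b p ends a₁ a₂ b _ (PD_sub ends a₁ a₂ a₃)
  have hgap := gap_eq_Q p ends a₁ a₂ b
  unfold Gc DEF EQbo EQb3 EQb3o EQo EQ3 EQ3o PDb PDbo Do
  simp only [Set.inter_self, eQ, eQ', eT, eT', eTp, eTp', ePD, ePD', prob_empty]
  rw [hgap, sQ, sQL, sQH, sT, sTp, sPD]
  simp only [A₀, A₁, A₂, B₀, B₁, B₂, p₀, p₁, p₂]
  ring

/-- **The diagonal (HCOV)**: `0 ≤ Gc p ends b a₁ a₂ a₃ b` for every weighted graph and all vertices. -/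
theorem Gc_diag_nonneg (p : E → R) (hp : IsProbVec p) (ends : E → Sym2 V) (a₁ a₂ a₃ b : V) :
    0 ≤ Gc p ends b a₁ a₂ a₃ b := by
  have h := Gc_diag_eq p ends a₁ a₂ a₃ b
  dsimp only at h
  rw [h]
  exact poly_nonneg (prob_nonneg hp _) (prob_nonneg hp _) (prob_nonneg hp _) (prob_nonneg hp _)
    (prob_nonneg hp _) (prob_nonneg hp _) (prob_nonneg hp _) (prob_nonneg hp _) (prob_nonneg hp _)

/-- **Row 2′HCOV-DIAG**: `HCov` holds on the diagonal `o = b`. -/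
theorem HCov_diag (p : E → R) (hp : IsProbVec p) (ends : E → Sym2 V) (a₁ a₂ a₃ b : V) :
    HCov p ends b a₁ a₂ a₃ b :=
  Gc_diag_nonneg p hp ends a₁ a₂ a₃ b

end HCovDiag
end Summit.Ventures.PercRepro2
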